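import Literature.NumberTheory.GaloisRepresentations.FrobeniusDensity
import Literature.NumberTheory.Automorphic.ChebotarevArtinRepHolds
import Literature.NumberTheory.GaloisRepresentations.ArtinFormalismInductionProofs
import HarnessLib

/-!
# Frobenius elements at places of residue degree one over a subfield are dense in `Γ_M`
# (the «over-field trick»: Chebotarev over the subfield in existence form only)

Topic `NumberTheory/GaloisRepresentations`; namespace `Literature.NumberTheory.GaloisRepresentations`.
A *proofs* file (theorems only; no definition, no named fact, no instance).

**The lemma.** Let `K ⊆ M` be number fields (any finite extension, not necessarily Galois) and `S` a
finite set of finite places of `M`.  Then the arithmetic Frobenius elements `σ ∈ Γ_M = Gal(M̄/M)` at the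
primes `𝔔` of `\bar ℤ_M` above places `w ∉ S` of `M` **of residue degree `f(w | w ∩ K) = 1` over `K`** form
a DENSE subset of `Γ_M` (`absoluteGaloisGroup.frobenius_dense_inertiaDeg_one`).  For `K = F⁺ ⊆ F = M` a CM
field these are, up to the finitely many ramified places, the places of `F` SPLIT over `F⁺`; for `K = ℚ`
they are the places of absolute residue degree one.

**Proof (over-field trick, no density theorem).**  Restriction `res : Γ_M ↪ Γ_K` (`absGaloisRestrict`, an
embedding with open image of index `[M : K]`).  Given `σ ∈ Γ_M` and a finite normal `E/M`, the image
`res(Gal(M̄/E))` is an open neighbourhood of `1` in `Γ_K`, so it contains `Gal(K̄/E′)` for a finite normal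
`E′/K` (Krull topology); Chebotarev in EXISTENCE form over `K` (`Automorphic.chebotarev_artinRep_holds`,
through the faithful Artin representation of `Gal(E′/K)`, `absoluteGaloisGroup.exists_framedArtinRep_restrictNormalHom_eq`)
supplies a place `v` of `K` below no place of `S` and an arithmetic Frobenius `fr ∈ res(σ)·Gal(K̄/E′)` at a
prime `𝔓 ∣ v`; hence `fr = res(φ)` with `φ ∈ σ·Gal(M̄/E)`.  TRANSPORT (`isArithFrobAt_of_absGaloisRestrict`):
along `\bar ℤ_K ≅ \bar ℤ_M` (`AbsIntegersEquiv`), `φ` acts on `\bar ℤ_M / 𝔔` (`𝔔 ↔ 𝔓`) as `x ↦ x^{N v}`; since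
`φ` fixes `𝓞 M`, the residue field of `w = 𝔔 ∩ 𝓞 M` is fixed by `x ↦ x^{N v}`, so `f(w|v) = 1`
(`inertiaDeg_dvd_of_forall_pow_residueCard_pow_eq`), `N w = N v`, and `φ` IS an arithmetic Frobenius of `M`
at `𝔔`.  (Serre, *Abelian `ℓ`-adic representations* I-2.2, Cor. 2 (a) is the case `K = M`; the degree-one
refinement is Neukirch, *Algebraic Number Theory* VII (13.2)/(13.6) in existence form.)

Consumer: the companion density lemma of the d6 line card (`Cruxes/HLiu418/Lines/d6_cm_curve`, stub S5
«dichotomy rigidity», A-plan2 (g11)): feeds `FramedGaloisRep.eq_or_eq_of_frobenius_of_dense` /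
`HeckeCharacter.IsAlgebraic.eq_or_eq_of_valueAtUniformizer_of_dense` (`CharacterFromFrobeniusPair`) with the
place set «split over `F⁺`, outside `S`» that the congruence relation [Liu2021 Cor. D.9] is stated on.

## References
* J.-P. Serre, *Abelian ℓ-adic representations and elliptic curves* (1968), Ch. I §2.2 Cor. 2 (a). [SerreAbelianLadic1968]
* J. Neukirch, *Algebraic Number Theory* (1999), Ch. VII §13, (13.2), (13.6); Ch. I §9 (9.4). [NeukirchANT1999]
* Y. Liu, *Fourier–Jacobi cycles and arithmetic relative trace formula* (2021), App. D §D.4 (l. 5619). [Liu2021]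
-/

noncomputable section

open scoped NumberField Topology Pointwise
open IsDedekindDomain Field Filter

namespace Literature.NumberTheory.GaloisRepresentations

section Transport

variable {K M : Type} [Field K] [NumberField K] [Field M] [NumberField M] [Algebra K M]

/-- **Frobenius transport along `res : Γ_M → Γ_K` forces residue degree one.**  Let `𝔔` be a prime of
`\bar ℤ_M` whose contraction `𝔓 = ι⁻¹ 𝔔` to `\bar ℤ_K` lies above the place `v` of `K`, and let `φ ∈ Γ_M` be
such that `res φ` is an arithmetic Frobenius of `K` at `𝔓`.  Then the place `w = 𝔔 ∩ 𝓞 M` of `M` (above `v`,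
below `𝔔`) has residue degree `f(w|v) = 1`, and `φ` is an arithmetic Frobenius of `M` at `𝔔`.
[cite: NeukirchANT1999, Ch. I §9 (9.4)] [cite: SerreAbelianLadic1968, Ch. I §2.1] -/
theorem isArithFrobAt_of_absGaloisRestrict {v : HeightOneSpectrum (𝓞 K)}
    {𝔔 : Ideal (absIntegers (𝓞 M) M)} [𝔔.IsPrime]
    (h𝔓 : 𝔔.comap (absIntegersMap K M) ∈ v.primesAbove) {φ : absoluteGaloisGroup M}
    (hfr : IsArithFrobAt (𝓞 K) (absGaloisRestrict K M φ) (𝔔.comap (absIntegersMap K M))) :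
    ∃ w : HeightOneSpectrum (𝓞 M), w.asIdeal.under (𝓞 K) = v.asIdeal ∧ 𝔔 ∈ w.primesAbove ∧
      w.asIdeal.inertiaDeg (𝓞 K) = 1 ∧ IsArithFrobAt (𝓞 M) φ 𝔔 := by
  haveI : FiniteDimensional K M := Module.Finite.right ℚ K M
  obtain ⟨w, hwv, h𝔔w, hunder⟩ := exists_heightOneSpectrum_of_comap_absIntegersMap_mem_primesAbove h𝔓
  -- transport the Frobenius congruence to `\bar ℤ_M`
  have hφ : ∀ z : absIntegers (𝓞 M) M, φ • z - z ^ v.residueCard ∈ 𝔔 := by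
    rw [← forall_smul_sub_pow_mem_comap_iff K M 𝔔 φ]
    exact (v.isArithFrobAt_iff_of_mem_primesAbove h𝔓 _).1 hfr
  -- `φ` fixes `𝓞 M`, so the residue field of `w` is fixed by `x ↦ x ^ N v`: `f(w|v) ∣ 1`
  have hdeg : w.asIdeal.inertiaDeg (𝓞 K) = 1 := by
    refine Nat.dvd_one.mp (inertiaDeg_dvd_of_forall_pow_residueCard_pow_eq hwv (m := 1) fun x => ?_)
    obtain ⟨r, rfl⟩ := Ideal.Quotient.mk_surjective x
    rw [pow_one, ← map_pow, Ideal.Quotient.eq, hunder, Ideal.under, Ideal.mem_comap, map_sub, map_pow]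
    have := hφ (algebraMap (𝓞 M) (absIntegers (𝓞 M) M) r)
    rw [smul_algebraMap] at this
    rw [← neg_mem_iff, neg_sub]
    exact this
  have hcard : w.residueCard = v.residueCard := by
    rw [residueCard_eq_pow_inertiaDeg_of_under_eq hwv, hdeg, pow_one]
  refine ⟨w, hwv, h𝔔w, hdeg, (w.isArithFrobAt_iff_of_mem_primesAbove h𝔔w φ).2 ?_⟩
  rw [hcard]
  exact hφ

end Transport

section Density

variable (K M : Type) [Field K] [NumberField K] [Field M] [NumberField M] [Algebra K M]

/-- **Frobenius elements at places of residue degree one over `K` are dense in `Γ_M`.**  For number fields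
`K ⊆ M` and a finite set `S` of finite places of `M`, the set of `σ ∈ Γ_M` which are an arithmetic Frobenius
at some prime `𝔔 ∈ w.primesAbove` of `\bar ℤ_M` over a place `w ∉ S` with `f(w | w ∩ K) = 1`
(Mathlib `Ideal.inertiaDeg`) is dense for the Krull topology.  Over-field trick: Chebotarev over `K` in
EXISTENCE form (`Automorphic.chebotarev_artinRep_holds`) + the transport `isArithFrobAt_of_absGaloisRestrict`;
no density theorem is used.  (`K = M`: Serre I-2.2 Cor. 2 (a), `absoluteGaloisGroup.frobenius_dense`.)
[cite: SerreAbelianLadic1968, Ch. I §2.2 Cor. 2 (a) p. I-8] [cite: NeukirchANT1999, Ch. VII §13 (13.6)] -/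
theorem absoluteGaloisGroup.frobenius_dense_inertiaDeg_one (S : Set (HeightOneSpectrum (𝓞 M)))
    (hS : S.Finite) :
    Dense {σ : absoluteGaloisGroup M | ∃ w ∉ S, w.asIdeal.inertiaDeg (𝓞 K) = 1 ∧
      ∃ 𝔔 ∈ w.primesAbove, IsArithFrobAt (𝓞 M) σ 𝔔} := by
  classical
  haveI : FiniteDimensional K M := Module.Finite.right ℚ K M
  set res : absoluteGaloisGroup M →ₜ* absoluteGaloisGroup K := absGaloisRestrict K M with hres
  -- the finitely many places of `K` below `S`
  set SK : Set (HeightOneSpectrum (𝓞 K)) :=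
    (fun w : HeightOneSpectrum (𝓞 M) => w.under (𝓞 K)) '' S with hSK
  have hSKf : SK.Finite := hS.image _
  -- the image `H = res(Γ_M)` is open (closed of finite index)
  have hHo : IsOpen ((absGaloisRestrict K M).range : Set (absoluteGaloisGroup K)) := by
    haveI := finiteIndex_range_absGaloisRestrict (K := K) (M := M)
    exact Subgroup.isOpen_of_isClosed_of_finiteIndex _ (isClosed_range_absGaloisRestrict K M)
  have key : ∀ (σ : absoluteGaloisGroup M) (E : IntermediateField M (AlgebraicClosure M)),
      FiniteDimensional M E → Normal M E →
      ∃ τ ∈ {σ : absoluteGaloisGroup M | ∃ w ∉ S, w.asIdeal.inertiaDeg (𝓞 K) = 1 ∧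
          ∃ 𝔔 ∈ w.primesAbove, IsArithFrobAt (𝓞 M) σ 𝔔},
        (absoluteGaloisGroup.toAlgEquiv M σ)⁻¹ * absoluteGaloisGroup.toAlgEquiv M τ ∈
          E.fixingSubgroup := by
    intro σ E hfin hnorm
    -- `U = Gal(M̄/E)` inside `Γ_M`: open and closed
    set U : Set (absoluteGaloisGroup M) :=
      {u | absoluteGaloisGroup.toAlgEquiv M u ∈ E.fixingSubgroup} with hU
    have hUo : IsOpen U := IntermediateField.fixingSubgroup_isOpen E
    -- `res '' U` is open in `Γ_K`: it is `H` minus the compact `res '' Uᶜ`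
    have hcl : IsClosed (res '' Uᶜ) :=
      ((hUo.isClosed_compl).isCompact.image (map_continuous res)).isClosed
    have heq : res '' U = ((absGaloisRestrict K M).range : Set (absoluteGaloisGroup K)) ∩ (res '' Uᶜ)ᶜ := by
      ext g
      constructor
      · rintro ⟨u, hu, rfl⟩
        refine ⟨⟨u, rfl⟩, ?_⟩
        rintro ⟨u', hu', he⟩
        exact hu' (by rwa [absGaloisRestrict_injective K M he])
      · rintro ⟨⟨u, rfl⟩, hnot⟩
        by_cases hu : u ∈ U
        · exact ⟨u, hu, rfl⟩
        · exact (hnot ⟨u, hu, rfl⟩).elim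
    have hVo : IsOpen (res '' U) := by
      rw [heq]
      exact hHo.inter hcl.isOpen_compl
    have h1 : (1 : absoluteGaloisGroup K) ∈ res '' U :=
      ⟨1, by simp only [hU, Set.mem_setOf_eq, map_one]; exact one_mem _, map_one res⟩
    obtain ⟨E', hfin', hnorm', hE'⟩ :=
      (krullTopology_mem_nhds_one_iff_of_normal K (AlgebraicClosure K) _).1 (hVo.mem_nhds h1)
    -- Chebotarev over `K` for a faithful Artin representation of `Gal(E'/K)`
    haveI := hfin'
    haveI := hnorm'
    obtain ⟨N, ρ, hρ⟩ := absoluteGaloisGroup.exists_framedArtinRep_restrictNormalHom_eq E'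
    obtain ⟨v, ⟨-, 𝔓, h𝔓, fr, hfr, hρfr⟩, hvS⟩ :=
      ((Automorphic.chebotarev_artinRep_holds K N ρ (res σ)).sdiff hSKf).nonempty
    -- `(res σ)⁻¹ fr` fixes `E'`, hence lies in `res '' U`
    have hmem : (res σ)⁻¹ * fr ∈ res '' U := by
      apply hE'
      have heq' := hρ fr (res σ) hρfr
      rw [SetLike.mem_coe, IntermediateField.mem_fixingSubgroup_iff]
      intro x hx
      have hx1 := AlgEquiv.restrictNormalHom_apply E' (absoluteGaloisGroup.toAlgEquiv K fr) ⟨x, hx⟩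
      have hx2 := AlgEquiv.restrictNormalHom_apply E' (absoluteGaloisGroup.toAlgEquiv K (res σ)) ⟨x, hx⟩
      rw [heq'] at hx1
      have h12 : absoluteGaloisGroup.toAlgEquiv K fr x = absoluteGaloisGroup.toAlgEquiv K (res σ) x :=
        hx1.symm.trans hx2
      change ((absoluteGaloisGroup.toAlgEquiv K (res σ))⁻¹ * absoluteGaloisGroup.toAlgEquiv K fr) x = x
      rw [AlgEquiv.mul_apply, AlgEquiv.aut_inv, AlgEquiv.symm_apply_eq]
      exact h12
    obtain ⟨u, hu, hue⟩ := hmem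
    -- the Frobenius of `M`: `φ := σ u`, `res φ = fr`
    have hresφ : res (σ * u) = fr := by
      rw [map_mul, hue, mul_inv_cancel_left]
    -- transport the prime: `𝔔 ↔ 𝔓` under `\bar ℤ_K ≅ \bar ℤ_M`
    set 𝔔 : Ideal (absIntegers (𝓞 M) M) :=
      𝔓.comap ((absIntegersEquiv K M).symm : absIntegers (𝓞 M) M →+* absIntegers (𝓞 K) K) with h𝔔def
    haveI h𝔓p : 𝔓.IsPrime := h𝔓.1
    haveI : 𝔔.IsPrime := Ideal.comap_isPrime _ 𝔓
    have hcomap : 𝔔.comap (absIntegersMap K M) = 𝔓 := by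
      rw [h𝔔def, Ideal.comap_comap]
      have hid : ((absIntegersEquiv K M).symm : absIntegers (𝓞 M) M →+* absIntegers (𝓞 K) K).comp
          (absIntegersMap K M) = RingHom.id _ := by
        ext x
        exact congrArg Subtype.val ((absIntegersEquiv K M).symm_apply_apply x)
      rw [hid, Ideal.comap_id]
    have h𝔓' : 𝔔.comap (absIntegersMap K M) ∈ v.primesAbove := by rw [hcomap]; exact h𝔓
    have hfr' : IsArithFrobAt (𝓞 K) (absGaloisRestrict K M (σ * u)) (𝔔.comap (absIntegersMap K M)) := by
      rw [hcomap, ← hres, hresφ]; exact hfr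
    obtain ⟨w, hwv, h𝔔w, hdeg, hφ⟩ := isArithFrobAt_of_absGaloisRestrict h𝔓' hfr'
    refine ⟨σ * u, ⟨w, ?_, hdeg, 𝔔, h𝔔w, hφ⟩, ?_⟩
    · -- `w ∉ S`: the place of `K` below `w` is `v ∉ SK`
      intro hwS
      apply hvS
      refine ⟨w, hwS, HeightOneSpectrum.ext ?_⟩
      rw [HeightOneSpectrum.under_asIdeal]
      exact hwv
    · -- `σ⁻¹ (σ u) = u ∈ Gal(M̄/E)`
      have : (absoluteGaloisGroup.toAlgEquiv M σ)⁻¹ * absoluteGaloisGroup.toAlgEquiv M (σ * u) =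
          absoluteGaloisGroup.toAlgEquiv M u := by
        rw [map_mul, inv_mul_cancel_left]
      rw [this]
      exact hu
  exact AlgEquiv.dense_of_forall_exists_mem_fixingSubgroup
    (K := M) (L := AlgebraicClosure M) fun σ E hfin hnorm ↦ key σ E hfin hnorm

/-- **Eventually form**: the same with the exceptional places given by a cofinite filter condition —
for every property `P` of places of `M` holding at all but finitely many places, the arithmetic Frobenii at
degree-one places satisfying `P` are dense. [cite: SerreAbelianLadic1968, Ch. I §2.2 Cor. 2 (a) p. I-8] -/
theorem absoluteGaloisGroup.frobenius_dense_inertiaDeg_one_of_eventually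
    {P : HeightOneSpectrum (𝓞 M) → Prop} (hP : ∀ᶠ w in cofinite, P w) :
    Dense {σ : absoluteGaloisGroup M | ∃ w, P w ∧ w.asIdeal.inertiaDeg (𝓞 K) = 1 ∧
      ∃ 𝔔 ∈ w.primesAbove, IsArithFrobAt (𝓞 M) σ 𝔔} := by
  have hS : {w | ¬ P w}.Finite := Filter.eventually_cofinite.1 hP
  refine (absoluteGaloisGroup.frobenius_dense_inertiaDeg_one K M {w | ¬ P w} hS).mono ?_
  rintro σ ⟨w, hw, hdeg, 𝔔, h𝔔, hσ⟩
  exact ⟨w, not_not.1 hw, hdeg, 𝔔, h𝔔, hσ⟩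

/-- **Consumer shape** (the `hP` hypothesis of `HeckeCharacter.IsAlgebraic.eq_or_eq_of_valueAtUniformizer_of_dense`
and, per finite `T`, of `FramedGaloisRep.eq_or_eq_of_frobenius_of_dense` in `CharacterFromFrobeniusPair`): any
set `P` of places of `M` containing ALL BUT FINITELY MANY places of residue degree one over `K` — e.g. the
places split over `K`, or unramified of degree one, since only finitely many places ramify — is
Frobenius-dense in the strong sense: for every finite `T`, the arithmetic Frobenii at places `w ∈ P`, `w ∉ T`
are dense in `Γ_M`. [cite: SerreAbelianLadic1968, Ch. I §2.2 Cor. 2 (a) p. I-8] [cite: NeukirchANT1999, Ch. VII §13 (13.6)] -/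
theorem absoluteGaloisGroup.frobenius_dense_of_eventually_inertiaDeg_one_mem
    {P : Set (HeightOneSpectrum (𝓞 M))} (hP : ∀ᶠ w in cofinite, w.asIdeal.inertiaDeg (𝓞 K) = 1 → w ∈ P)
    (T : Set (HeightOneSpectrum (𝓞 M))) (hT : T.Finite) :
    Dense {σ : absoluteGaloisGroup M | ∃ w ∈ P, w ∉ T ∧
      ∃ 𝔔 ∈ w.primesAbove, IsArithFrobAt (𝓞 M) σ 𝔔} := by
  have hS : (T ∪ {w | ¬ (w.asIdeal.inertiaDeg (𝓞 K) = 1 → w ∈ P)}).Finite :=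
    hT.union (Filter.eventually_cofinite.1 hP)
  refine (absoluteGaloisGroup.frobenius_dense_inertiaDeg_one K M _ hS).mono ?_
  rintro σ ⟨w, hw, hdeg, 𝔔, h𝔔, hσ⟩
  rw [Set.mem_union, not_or, Set.mem_setOf_eq, not_not] at hw
  exact ⟨w, hw.2 hdeg, hw.1, 𝔔, h𝔔, hσ⟩

end Density

end Literature.NumberTheory.GaloisRepresentations

end
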